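import Mathlib.Data.Nat.Log
import Mathlib.Algebra.Polynomial.Eval.Defs
import Literature.Computability.Complexity.TimeBounds
import Literature.Computability.Complexity.Circuit
import Literature.Computability.Complexity.CircuitClasses
import HarnessLib

-- provenance: harness21/H21/H21/Prelude/CplxCore/ConstantDepth.lean @ ecd7fd8 (interim HEAD d8f2665); M5 mechanical rewrite
/-!
# Unbounded fan-in bases and constant-depth circuit classes (trunk CplxCore, item C15)

This file defines the unbounded fan-in bases `acBasis = {¬} ∪ {∧ₖ, ∨ₖ | k ∈ ℕ}`,
`accBasis m = acBasis ∪ {MODₘ,ₖ | k}`, `tcBasis = acBasis ∪ {MAJₖ | k}`, the depth measure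
`Circuit.acDepth` in which negation gates are free, the generic depth/size class
`DepthSizeClass B d s`, and the standard classes

* `AC0`  — constant depth, polynomial size over `acBasis`;
* `AC0Mod m` (`AC⁰[m]`), `ACC0 = ⋃_{m ≥ 2} AC⁰[m]`;
* `TC0`  — constant depth, polynomial size over `tcBasis` (majority gates);
* `NC k` — depth `O(logᵏ n)`, polynomial size over the bounded fan-in basis `B₂`, `NC1 = NC 1`;
* `ACd d` — the `d`-th level of `AC⁰`;

together with the parity function `parityFn`, the language `PARITY`, and P-uniformity of a
circuit family relative to an encoding of circuits (`CircuitFamily.IsUniformVia`).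
The API records the textbook chain `AC⁰ ⊆ AC⁰[m] ⊆ ACC⁰ ⊆ TC⁰ ⊆ NC¹ ⊆ P/poly` and
`PARITY ∈ NC¹`.

Sources: S. Arora, B. Barak, *Computational Complexity: A Modern Approach* (2009), Def. 6.23
(NC, AC), §14.1 (AC⁰, PARITY), Def. 14.3–14.4 (ACC⁰[m], ACC⁰), §14.4.2 (TC⁰);
H. Vollmer, *Introduction to Circuit Complexity* (1999), §1.2 (unbounded fan-in, depth with free
negations), Def. 4.5 (uniformity), §4.4 (TC⁰ ⊆ NC¹), Cor. 1.31 (parity in NC¹).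

Mathlib has no Boolean circuits or circuit classes (searched `AC0`, `NC`, `parity`, `circuit`:
only unrelated `Matroid.IsCircuit`, `CoxeterSystem.lengthParity`); we reuse `Nat.log`,
`Polynomial.eval`, `Language`, `Computability.unaryEncodeNat` and the H21 prelude (`Circuit`,
`GateFn`, `deMorganBasis`, `CircuitFamily`, `CircuitFamily.Decides`, `PPoly`,
`PolyTimeComputable`).

Design choices:
* Depth of unbounded fan-in circuits is measured by `acDepth = depthWith acWeight`, where
  negations weigh `0` and every other gate `1` (Vollmer 1999, §1.2: negations may be pushed to
  the inputs without changing the class). For `NC k` (bounded fan-in) the same measure is used;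
  since double negations can be removed and single negations merged into a level, it changes
  depth by at most a factor `2` and gives the same classes `NC k`.
* Deviation from the outline wording: `NC k` is defined over `B2` (all gates of fan-in `≤ 2`,
  the basis already used by `PPoly`/`SIZE`; Arora–Barak Def. 6.23 "bounded fan-in") instead of
  `deMorganBasis = {∧₂, ∨₂, ¬}`. The De Morgan basis has no constant gates, so there is no
  De Morgan circuit at all on `Fin 0` inputs and every class of circuit *families* over it would
  be empty. Every `B₂`-gate is a De Morgan circuit of size `≤ 5` and depth `≤ 3` (for `n ≥ 1`),
  so the classes `NC k` are the textbook ones. `AC0`, `AC0Mod`, `TC0` are unaffected since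
  `acBasis` contains the constants `∧₀ = true`, `∨₀ = false`. Non-vacuity: `zero_mem_NC_zero`.
* `NC k` uses the depth bound `c * (Nat.log 2 n) ^ k + c` (arithmetic `O`-form, outline D2);
  `Nat.log 2 0 = Nat.log 2 1 = 0`.
* `ACC0 = ⋃ m ≥ 2, AC0Mod m`: for `m = 1` the gate `MOD₁` is constantly `false` and for
  `m = 0` it is `∨ₖ` (see `GateFn.modGate`), so including them would not change the union, but
  we follow Arora–Barak Def. 14.4 literally.
* Uniformity is parametrised by an encoding `enc n : Circuit (Fin n) → List Bool` of circuits as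
  bit strings (outline R6): `IsUniformVia enc C` says `1ⁿ ↦ enc n (C n)` is polynomial-time
  computable (P-uniformity, Vollmer Def. 4.5 / Arora–Barak Def. 6.12).
* All classes are `Set (Language Bool)` in `namespace Literature.CplxCore`, named by their acronyms
  (outline D7); definitions through `CircuitFamily.Decides` are `noncomputable`.
-/

namespace Literature.Computability.Complexity

open _root_.Computability

/-! ### Unbounded fan-in bases -/

/-- The AC basis `{¬} ∪ {∧ₖ, ∨ₖ | k ∈ ℕ}`: negation and conjunctions/disjunctions of every
arity (unbounded fan-in) (Arora–Barak 2009, §14.1; Vollmer 1999, §1.2). [cite: AroraBarak2009, §14.1] -/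
def acBasis : Set GateFn := {GateFn.not} ∪ ⋃ k : ℕ, {GateFn.and k, GateFn.or k}

/-- The ACC basis with modulus `m`: the AC basis together with the gates `MODₘ` of every arity
(Arora–Barak 2009, Def. 14.3). [cite: AroraBarak2009, Def. 14.3] -/
def accBasis (m : ℕ) : Set GateFn := acBasis ∪ ⋃ k : ℕ, {GateFn.modGate m k}

/-- The TC basis: the AC basis together with the majority gates `MAJₖ` of every arity
(Arora–Barak 2009, §14.4.2; Vollmer 1999, Def. 1.9). [cite: AroraBarak2009, §14.4.2] -/
def tcBasis : Set GateFn := acBasis ∪ ⋃ k : ℕ, {GateFn.maj k}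

/-- The AC depth weight: negation gates weigh `0`, all other gates weigh `1`, so that
`depthWith acWeight` counts alternations of unbounded fan-in gates only (Vollmer 1999, §1.2).
A gate counts as a negation iff it *is* `GateFn.not` extensionally (arity `1` and truth table
`!`); equality of gate functions is decidable via `Fintype.decidablePiFintype`. [cite: Vollmer1999, §1.2] -/
def acWeight (f : GateFn) : ℕ := if f = GateFn.not then 0 else 1

/-- The depth of a circuit with negations free: `depthWith acWeight` (Vollmer 1999, §1.2). [cite: Vollmer1999, §1.2] -/
def Circuit.acDepth {ι : Type*} (C : Circuit ι) : ℕ := C.depthWith acWeight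

/-! ### Depth/size classes -/

/-- `DepthSizeClass B d s`: the languages decided by a circuit family `(Cₙ)` over the basis `B`
with `acDepth Cₙ ≤ d n` and `|Cₙ| ≤ s n` for every `n` (Vollmer 1999, §1.2; Arora–Barak 2009,
Def. 6.23). Noncomputable (`CircuitFamily.Decides`). [cite: Vollmer1999, §1.2] -/
noncomputable def DepthSizeClass (B : Set GateFn) (d s : ℕ → ℕ) : Set (Language Bool) :=
  {L | ∃ C : CircuitFamily,
    (∀ n, (C n).IsOver B ∧ (C n).acDepth ≤ d n ∧ (C n).size ≤ s n) ∧ C.Decides L}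

/-- `ACd d` (`AC⁰_d`): languages decided by depth-`d`, polynomial-size circuit families over the
unbounded fan-in AC basis (Arora–Barak 2009, §14.1; Vollmer 1999, §1.2). [cite: AroraBarak2009, §14.1] -/
noncomputable def ACd (d : ℕ) : Set (Language Bool) :=
  ⋃ p : Polynomial ℕ, DepthSizeClass acBasis (fun _ => d) (fun n => p.eval n)

/-- `AC⁰`: languages decided by constant-depth, polynomial-size circuit families of unbounded
fan-in `∧`, `∨`, `¬` gates (Arora–Barak 2009, §14.1 and Def. 6.23). [cite: AroraBarak2009, §14.1 and Def. 6.23] -/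
noncomputable def AC0 : Set (Language Bool) :=
  {L | ∃ d : ℕ, ∃ p : Polynomial ℕ, L ∈ DepthSizeClass acBasis (fun _ => d) (fun n => p.eval n)}

/-- `AC⁰[m]`: constant-depth, polynomial-size circuit families over `∧`, `∨`, `¬`, `MODₘ`
(Arora–Barak 2009, Def. 14.3). [cite: AroraBarak2009, Def. 14.3] -/
noncomputable def AC0Mod (m : ℕ) : Set (Language Bool) :=
  {L | ∃ d : ℕ, ∃ p : Polynomial ℕ,
    L ∈ DepthSizeClass (accBasis m) (fun _ => d) (fun n => p.eval n)}

/-- `ACC⁰ = ⋃_{m ≥ 2} AC⁰[m]` (Arora–Barak 2009, Def. 14.4). Arora–Barak allow a tuple of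
moduli `m₁, …, mₖ`; since `AC⁰[m₁, …, mₖ] = AC⁰[m₁ ⋯ mₖ]`, a single modulus gives the same
union. [cite: AroraBarak2009, Def. 14.4] -/
noncomputable def ACC0 : Set (Language Bool) := ⋃ m ≥ 2, AC0Mod m

/-- `TC⁰`: constant-depth, polynomial-size circuit families over `∧`, `∨`, `¬` and majority gates
(Arora–Barak 2009, §14.4.2; Vollmer 1999, §4.4). [cite: AroraBarak2009, §14.4.2] -/
noncomputable def TC0 : Set (Language Bool) :=
  {L | ∃ d : ℕ, ∃ p : Polynomial ℕ, L ∈ DepthSizeClass tcBasis (fun _ => d) (fun n => p.eval n)}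

/-- `NCᵏ`: languages decided by polynomial-size circuit families over the bounded fan-in
basis `B₂` (all gates of fan-in `≤ 2`, Arora–Barak 2009, Def. 6.23: "fan-in at most two") of
depth `O(logᵏ n)`, in the arithmetic form `acDepth Cₙ ≤ c * (log₂ n)^k + c`. Non-uniform
version. The basis is `B2` rather than the De Morgan basis `{∧₂, ∨₂, ¬}` (outline wording)
because the latter has no constants and hence no circuit on `Fin 0` inputs, which would make
every family-based class over it empty; over `B₂` every `B₂`-gate is a constant-size De Morgan
circuit, so for `n ≥ 1` the classes agree. [cite: AroraBarak2009, Def. 6.23: "fan-in at most two"] -/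
noncomputable def NC (k : ℕ) : Set (Language Bool) :=
  {L | ∃ c : ℕ, ∃ p : Polynomial ℕ,
    L ∈ DepthSizeClass B2 (fun n => c * Nat.log 2 n ^ k + c) (fun n => p.eval n)}

/-- `NC¹ = NC 1`: logarithmic depth, polynomial size, fan-in `≤ 2`
(Arora–Barak 2009, Def. 6.23). [cite: AroraBarak2009, Def. 6.23] -/
noncomputable def NC1 : Set (Language Bool) := NC 1

/-! ### Parity -/

/-- The parity function on `n` bits: `true` iff an odd number of inputs are `true`
(Arora–Barak 2009, §14.1). [cite: AroraBarak2009, §14.1] -/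
def parityFn (n : ℕ) (x : Fin n → Bool) : Bool := decide (GateFn.numOnes x % 2 = 1)

/-- `parityFn n` is the truth table of the parity gate `⊕ₙ` (Vollmer 1999, §1.1). [cite: Vollmer1999, §1.1] -/
theorem parityFn_eq_xor (n : ℕ) : parityFn n = (GateFn.xor n).2 := rfl

/-- The language `PARITY = {x ∈ {0,1}* | x has an odd number of ones}`
(Arora–Barak 2009, §14.1, Thm. 14.1). [cite: AroraBarak2009, §14.1  Thm. 14.1] -/
def PARITY : Language Bool := {x | parityFn x.length x.get = true}

/-! ### Uniformity -/

/-- P-uniformity of a circuit family relative to an encoding `enc n : Circuit (Fin n) → {0,1}*`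
of circuits: the map `1ⁿ ↦ enc n (C n)` is computable in polynomial time
(Arora–Barak 2009, Def. 6.12; Vollmer 1999, Def. 4.5). The encoding is a parameter
(outline R6). [cite: AroraBarak2009, Def. 6.12] -/
def CircuitFamily.IsUniformVia (enc : ∀ n, Circuit (Fin n) → List Bool) (C : CircuitFamily) :
    Prop :=
  PolyTimeComputable unaryEncodeNat id (fun n => enc n (C n))

/-! ### API -/

/-- `acBasis ⊆ accBasis m` (Arora–Barak 2009, Def. 14.3). [cite: AroraBarak2009, Def. 14.3] -/
theorem acBasis_subset_accBasis (m : ℕ) : acBasis ⊆ accBasis m := Set.subset_union_left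

/-- `acBasis ⊆ tcBasis` (Arora–Barak 2009, §14.4.2). [cite: AroraBarak2009, §14.4.2] -/
theorem acBasis_subset_tcBasis : acBasis ⊆ tcBasis := Set.subset_union_left

/-- `DepthSizeClass` is monotone in the basis and in the depth and size bounds
(Vollmer 1999, §1.2). [cite: Vollmer1999, §1.2] -/
theorem DepthSizeClass_mono {B B' : Set GateFn} {d d' s s' : ℕ → ℕ} (hB : B ⊆ B')
    (hd : ∀ n, d n ≤ d' n) (hs : ∀ n, s n ≤ s' n) :
    DepthSizeClass B d s ⊆ DepthSizeClass B' d' s' := by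
  rintro L ⟨C, hC, hL⟩
  exact ⟨C, fun n => ⟨(hC n).1.mono hB, (hC n).2.1.trans (hd n), (hC n).2.2.trans (hs n)⟩, hL⟩

/-- `AC⁰ = ⋃_d AC⁰_d` (Arora–Barak 2009, §14.1). [cite: AroraBarak2009, §14.1] -/
theorem AC0_eq_iUnion_ACd : AC0 = ⋃ d, ACd d := by
  ext L
  simp only [AC0, ACd, Set.mem_setOf_eq, Set.mem_iUnion]

/-- `AC⁰ ⊆ AC⁰[m]` (Arora–Barak 2009, Def. 14.3). [cite: AroraBarak2009, Def. 14.3] -/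
theorem AC0_subset_AC0Mod (m : ℕ) : AC0 ⊆ AC0Mod m := by
  rintro L ⟨d, p, hL⟩
  exact ⟨d, p, DepthSizeClass_mono (acBasis_subset_accBasis m) (fun _ => le_rfl)
    (fun _ => le_rfl) hL⟩

/-- `AC⁰[m] ⊆ ACC⁰` for `m ≥ 2` (Arora–Barak 2009, Def. 14.4). [cite: AroraBarak2009, Def. 14.4] -/
theorem AC0Mod_subset_ACC0 {m : ℕ} (hm : 2 ≤ m) : AC0Mod m ⊆ ACC0 :=
  Set.subset_biUnion_of_mem (u := fun m => AC0Mod m) hm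

/-- `ACC⁰ ⊆ TC⁰`: a `MODₘ` gate is computed by a constant-depth polynomial-size threshold
circuit (Vollmer 1999, §4.4; Arora–Barak 2009, §14.4.2). [cite: Vollmer1999, §4.4] -/
def ACC0_subset_TC0 : Prop :=
  ACC0 ⊆ TC0

/-- `TC⁰ ⊆ NC¹`: majority (indeed iterated addition) has logarithmic-depth bounded fan-in
circuits (Vollmer 1999, Thm. 1.20 and Cor. 4.41). [cite: Vollmer1999, Thm. 1.20 and Cor. 4.41] -/
def TC0_subset_NC1 : Prop :=
  TC0 ⊆ NC1

/-- Non-vacuity of `NC`: the empty language `0` is in `NC⁰`, witnessed by the family of constant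
circuits `const false` (one gate of arity `0`, `acDepth = 1`) (Arora–Barak 2009, Def. 6.23). [cite: AroraBarak2009, Def. 6.23] -/
theorem zero_mem_NC_zero : (0 : Language Bool) ∈ NC 0 := by
  refine ⟨1, 1, fun n => Circuit.const (Fin n) false, fun n => ⟨?_, ?_, ?_⟩, ?_⟩
  · intro g hg
    simp only [Circuit.const, List.mem_singleton] at hg
    subst hg
    show (0 : ℕ) ≤ 2
    omega
  · show (Circuit.const (Fin n) false).acDepth ≤ 1 * Nat.log 2 n ^ 0 + 1
    have : (Circuit.const (Fin n) false).acDepth = 1 := by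
      simp only [Circuit.acDepth, Circuit.depthWith, Circuit.depthVals, Circuit.const,
        List.foldl_cons, List.foldl_nil, List.nil_append]
      rfl
    omega
  · simp
  · intro x
    simpa using ((0 : Language Bool).notMem_iff_boolIndicator x).1 (Language.notMem_zero x)

/-- `NC¹ ⊆ P/poly`: forget the depth bound (Arora–Barak 2009, Def. 6.23 and Def. 6.5). [cite: AroraBarak2009, Def. 6.23 and Def. 6.5] -/
theorem NC1_subset_PPoly : NC1 ⊆ PPoly := by
  rintro L ⟨c, p, C, hC, hL⟩
  exact Set.mem_iUnion.2 ⟨p, C, fun n => ⟨(hC n).1, (hC n).2.2⟩, hL⟩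

/-- `getD_le_of_forall₂` — interim theorem carried over undocumented from `harness21/H21/H21/Prelude/CplxCore/ConstantDepth.lean:227` (docstring generated by the M5 import). [folklore] -/
private theorem getD_le_of_forall₂ {l l' : List ℕ} (h : List.Forall₂ (· ≤ ·) l l') (m : ℕ) :
    l.getD m 0 ≤ l'.getD m 0 := by
  induction h generalizing m with
  | nil => simp
  | cons hab _ ih =>
    cases m with
    | zero => simpa using hab
    | succ m => simpa using ih m

/-- Weighted depth is monotone in the weight function (Vollmer 1999, §1.2). [cite: Vollmer1999, §1.2] -/
theorem Circuit.depthWith_mono {ι : Type*} (C : Circuit ι) {w w' : GateFn → ℕ}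
    (hw : ∀ g, w g ≤ w' g) : C.depthWith w ≤ C.depthWith w' := by
  open Finset in
  have key : ∀ (gs : List (Gate ι)) (ds ds' : List ℕ), List.Forall₂ (· ≤ ·) ds ds' →
      List.Forall₂ (· ≤ ·)
        (gs.foldl (fun ds g => ds ++
          [w g.fn + univ.sup fun a => match g.args a with
            | .inl _ => 0
            | .inr m => ds.getD m 0]) ds)
        (gs.foldl (fun ds g => ds ++
          [w' g.fn + univ.sup fun a => match g.args a with
            | .inl _ => 0
            | .inr m => ds.getD m 0]) ds') := by
    intro gs
    induction gs with
    | nil => intro ds ds' h; simpa using h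
    | cons g gs ih =>
      intro ds ds' h
      simp only [List.foldl_cons]
      refine ih _ _ (List.rel_append h (List.Forall₂.cons ?_ List.Forall₂.nil))
      refine Nat.add_le_add (hw _) (Finset.sup_mono_fun fun a _ => ?_)
      split
      · exact le_rfl
      · exact getD_le_of_forall₂ h _
  unfold Circuit.depthWith Circuit.depthVals
  split
  · exact le_rfl
  · exact getD_le_of_forall₂ (key C.gates [] [] List.Forall₂.nil) _

/-- Depth with free negations is at most the depth (every weight `acWeight g ≤ 1`)
(Vollmer 1999, §1.2). [cite: Vollmer1999, §1.2] -/
theorem acDepth_le_depth {ι : Type*} (C : Circuit ι) : C.acDepth ≤ C.depth :=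
  C.depthWith_mono fun g => by unfold acWeight; split <;> simp

/-- `PARITY ∈ NC¹`: parity of `n` bits is computed by a balanced tree of `⊕₂` gates, each of
constant De Morgan size, giving depth `O(log n)` and size `O(n)` (Vollmer 1999, Cor. 1.31;
Arora–Barak 2009, §14.1). [cite: Vollmer1999, Cor. 1.31] -/
def PARITY_mem_NC1 : Prop :=
  PARITY ∈ NC1

end Literature.Computability.Complexity
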